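import Summits.HubbardSuperconductivity.HubbardSuperconductivity.Theorems.BalabanIRBirEveryGroundStateSocket
import Summits.HubbardSuperconductivity.HubbardSuperconductivity.Theorems.BalabanIRBirEveryGroundStateHeadCount
import Literature.MathematicalPhysics.QuantumLattice.FinDimSpectrumSectorGibbsLimit

/-!
# Route `BalabanIR`, crux 5 `BirEveryGroundState` (`stmt-HubbardSuperconductivity-2083`):
# Theses-free CLOSER from the moment upgrade (the RESHAPE line), and the one-side moment bound

Companion of `BalabanIRBirEveryGroundStateSocket.lean`, importing NO route file and no Theorems
module that does (rev-5 MATERIALISATION RULE; `…HeadCount.lean` is route-file-free since its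
2026-08-16 revision). The route-file-importing `BalabanIRBirEveryGroundStateMoments.lean` proves
the moment endgame of `Cruxes/BirEveryGroundState/RESHAPE-ideator1.md` with the crux BY NAME;
this module re-establishes it STRUCTURALLY:

* `forall_groundState_bound_of_moments` — at ONE coupling `U` and ONE side `L`: if the projection
  `P` onto the sector ground eigenspace `E₀ = szSector N_L 0 ⊓ ker (H - e₀)` of
  `H = hubbardTorus 2 L 1 U` and `O = Δ_d† Δ_d` satisfy the average clause
  `c L⁴ · re tr P ≤ re tr (P O)` (`c ≥ 0`), the second-moment clause
  `re tr (P O P O) · re tr P ≤ (1 + ε) (re tr (P O))²` and the bounded-degeneracy clause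
  `re tr P ≤ D` with `ε D ≤ 1/4`, then EVERY normalised sector ground state has
  `(c/2) L⁴ ≤ re ⟨ψ, O ψ⟩` (compression variance head-count: the tracial variance of the
  compression is `≤ ε m ȳ² ≤ ȳ²/4`, so nobody falls below `ȳ/2`; no representation theory, no
  genericity). This is the side-wise primitive; `forall_hasLRO_iff_groundState_bound` (Socket)
  turns its eventual version into the summit's matrix at `U`.
* `birEveryGroundState_structural_of_moments` — the body of the item, verbatim, from the
  MOMENT-TRANSFER residual: the window average yields one coupling of the window with the three
  clauses eventually in even `L` (the engine-side upgrade proposed by the RESHAPE; NOT proved).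

The two generic steps (`compressionVarianceHeadCount`, `forall_unit_le_re_of_moments` of the
route-file-importing module) are repeated here as private lemmas, for the materialisation rule.
Bhatia, *Matrix Analysis* (1997) §I.2; Tasaki (2020) App. A.2; Scalapino, Phys. Rep. 250 (1995)
§2. Everything is folklore; no definition is introduced.
-/

noncomputable section

namespace Summit.HubbardSuperconductivity.HubbardSuperconductivity.Theorems

open Matrix Finset Filter
open Literature.Probability.LatticeModels Literature.MathematicalPhysics.QuantumLattice
open scoped ComplexOrder

section Moments

variable {n : Type*} [Fintype n] [DecidableEq n]

/-- Compression variance head-count (private copy of `compressionVarianceHeadCount` for the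
materialisation rule): `ȳ - √(re tr (P Y P Y) - m ȳ²) ≤ re ⟨ψ, Y ψ⟩` for every unit `ψ ∈ K`.
Bhatia §I.2. [folklore] -/
private theorem compressionVarianceHeadCount_free (Y : Matrix n n ℂ) (hY : Y.IsHermitian)
    (K : Submodule ℂ (n → ℂ)) (hK : K ≠ ⊥) {ψ : n → ℂ} (hψK : ψ ∈ K) (hψ : star ψ ⬝ᵥ ψ = 1) :
    let P : Matrix n n ℂ := projMatrix (K.map
      ((WithLp.linearEquiv 2 ℂ (n → ℂ)).symm : (n → ℂ) →ₗ[ℂ] EuclideanSpace ℂ n))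
    let m : ℝ := P.trace.re
    let ybar : ℝ := (P * Y).trace.re / m
    ybar - Real.sqrt ((P * Y * P * Y).trace.re - m * ybar ^ 2) ≤ (star ψ ⬝ᵥ Y *ᵥ ψ).re := by
  intro P m ybar
  have hPH : Pᴴ = P := (projMatrix_isHermitian _).eq
  have hPP : P * P = P := projMatrix_mul_self _
  have hPψ : P *ᵥ ψ = ψ := projMatrix_map_mulVec_of_mem K hψK
  -- `m = dim K > 0`, so `re tr (P Y) = m ȳ`
  have hm : m = (Module.finrank ℂ K : ℝ) := by
    show (projMatrix (K.map ((WithLp.linearEquiv 2 ℂ (n → ℂ)).symm :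
      (n → ℂ) →ₗ[ℂ] EuclideanSpace ℂ n))).trace.re = _
    rw [trace_projMatrix_map_eq_finrank, Complex.natCast_re]
  have hmpos : 0 < m := by
    rw [hm, Nat.cast_pos]
    exact Module.finrank_pos_iff.mpr (Submodule.nontrivial_iff_ne_bot.mpr hK)
  have hPY : (P * Y).trace.re = m * ybar := by
    show (P * Y).trace.re = m * ((P * Y).trace.re / m)
    field_simp
  -- the traceless Hermitian compression `D`
  set D : Matrix n n ℂ := P * Y * P - (ybar : ℂ) • P with hD
  have hDH : Dᴴ = D := by
    rw [hD, conjTranspose_sub, conjTranspose_smul, conjTranspose_mul, conjTranspose_mul, hPH,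
      hY.eq, Complex.star_def, Complex.conj_ofReal, Matrix.mul_assoc]
  -- (1) `re ⟨ψ, Y ψ⟩ - ȳ = re ⟨ψ, D ψ⟩`
  have h1 : (star ψ ⬝ᵥ D *ᵥ ψ).re = (star ψ ⬝ᵥ Y *ᵥ ψ).re - ybar := by
    have hadj : ∀ w, star ψ ⬝ᵥ (P *ᵥ w) = star (P *ᵥ ψ) ⬝ᵥ w := fun w => by
      rw [star_mulVec, hPH, ← dotProduct_mulVec]
    have hPYψ : star ψ ⬝ᵥ (P *ᵥ (Y *ᵥ ψ)) = star ψ ⬝ᵥ (Y *ᵥ ψ) := by rw [hadj, hPψ]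
    rw [hD, sub_mulVec, smul_mulVec, ← mulVec_mulVec, ← mulVec_mulVec, hPψ, dotProduct_sub,
      dotProduct_smul, hPYψ, hψ, Complex.sub_re, smul_eq_mul, mul_one, Complex.ofReal_re]
  -- (2) `re tr (D D) = re tr (P Y P Y) - m ȳ²`
  have h2 : (Dᴴ * D).trace.re = (P * Y * P * Y).trace.re - m * ybar ^ 2 := by
    rw [hDH, hD]
    have e1 : P * Y * P * (P * Y * P) = P * Y * P * Y * P := by
      calc P * Y * P * (P * Y * P) = P * Y * (P * P) * Y * P := by simp only [Matrix.mul_assoc]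
        _ = P * Y * P * Y * P := by rw [hPP]
    have e2 : P * Y * P * P = P * Y * P := by rw [Matrix.mul_assoc, hPP]
    have e3 : P * (P * Y * P) = P * Y * P := by rw [← Matrix.mul_assoc, ← Matrix.mul_assoc, hPP]
    have t1 : (P * Y * P * Y * P).trace = (P * Y * P * Y).trace := by
      rw [trace_mul_comm, ← Matrix.mul_assoc, ← Matrix.mul_assoc, ← Matrix.mul_assoc, hPP]
    have t2 : (P * Y * P).trace = (P * Y).trace := by
      rw [trace_mul_comm, ← Matrix.mul_assoc, hPP]
    simp only [Matrix.sub_mul, Matrix.mul_sub, Matrix.smul_mul, Matrix.mul_smul, e1, e2, e3, hPP,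
      trace_sub, trace_smul, t1, t2, smul_eq_mul, Complex.sub_re, Complex.re_ofReal_mul]
    have hPre : P.trace.re = m := rfl
    rw [hPY, hPre]
    ring
  have hsq : (star ψ ⬝ᵥ D *ᵥ ψ).re ^ 2 ≤ (P * Y * P * Y).trace.re - m * ybar ^ 2 := by
    have h := sq_re_star_dotProduct_mulVec_le D hψ
    rwa [h2] at h
  have hroot : -Real.sqrt ((P * Y * P * Y).trace.re - m * ybar ^ 2) ≤ (star ψ ⬝ᵥ D *ᵥ ψ).re := by
    rw [neg_le]
    calc -(star ψ ⬝ᵥ D *ᵥ ψ).re ≤ |(star ψ ⬝ᵥ D *ᵥ ψ).re| := neg_le_abs _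
      _ = Real.sqrt ((star ψ ⬝ᵥ D *ᵥ ψ).re ^ 2) := (Real.sqrt_sq_eq_abs _).symm
      _ ≤ Real.sqrt ((P * Y * P * Y).trace.re - m * ybar ^ 2) := Real.sqrt_le_sqrt hsq
  rw [h1] at hroot
  linarith

/-- Moments ⇒ every (private copy of `forall_unit_le_re_of_moments` for the materialisation rule):
average `≥ c₀`, second moment `≤ (1 + ε) mean²`, `re tr P ≤ D`, `ε D ≤ 1/4` ⇒ every unit
`ψ ∈ K` has `c₀ / 2 ≤ re ⟨ψ, Y ψ⟩`. Bhatia §I.2. [folklore] -/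
private theorem forall_unit_le_re_of_moments_free (Y : Matrix n n ℂ) (hY : Y.IsHermitian)
    (K : Submodule ℂ (n → ℂ)) (hK : K ≠ ⊥) {c₀ ε D : ℝ} (hc₀ : 0 ≤ c₀) (hε : 0 ≤ ε)
    (hεD : ε * D ≤ 1 / 4) :
    let P : Matrix n n ℂ := projMatrix (K.map
      ((WithLp.linearEquiv 2 ℂ (n → ℂ)).symm : (n → ℂ) →ₗ[ℂ] EuclideanSpace ℂ n))
    c₀ * P.trace.re ≤ (P * Y).trace.re →
    (P * Y * P * Y).trace.re * P.trace.re ≤ (1 + ε) * (P * Y).trace.re ^ 2 →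
    P.trace.re ≤ D →
    ∀ ψ ∈ K, star ψ ⬝ᵥ ψ = 1 → c₀ / 2 ≤ (star ψ ⬝ᵥ Y *ᵥ ψ).re := by
  intro P havg hmom hdeg ψ hψK hψ
  have hm : P.trace.re = (Module.finrank ℂ K : ℝ) := by
    show (projMatrix (K.map ((WithLp.linearEquiv 2 ℂ (n → ℂ)).symm :
      (n → ℂ) →ₗ[ℂ] EuclideanSpace ℂ n))).trace.re = _
    rw [trace_projMatrix_map_eq_finrank, Complex.natCast_re]
  have hmpos : 0 < P.trace.re := by
    rw [hm, Nat.cast_pos]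
    exact Module.finrank_pos_iff.mpr (Submodule.nontrivial_iff_ne_bot.mpr hK)
  have hhead : (P * Y).trace.re / P.trace.re -
      Real.sqrt ((P * Y * P * Y).trace.re - P.trace.re * ((P * Y).trace.re / P.trace.re) ^ 2) ≤
        (star ψ ⬝ᵥ Y *ᵥ ψ).re :=
    compressionVarianceHeadCount_free Y hY K hK hψK hψ
  -- write `re tr (P Y) = m ȳ`
  obtain ⟨ybar, hybar⟩ : ∃ ybar : ℝ, (P * Y).trace.re = P.trace.re * ybar :=
    ⟨(P * Y).trace.re / P.trace.re, by field_simp⟩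
  have hdiv : (P * Y).trace.re / P.trace.re = ybar := by
    rw [hybar, mul_div_cancel_left₀ _ hmpos.ne']
  rw [hdiv] at hhead
  rw [hybar] at havg hmom
  generalize hmm : P.trace.re = m at *
  generalize hT : (P * Y * P * Y).trace.re = T at *
  -- `c₀ ≤ ȳ`
  have hyc : c₀ ≤ ybar := le_of_mul_le_mul_left (by linarith [havg]) hmpos
  have hy0 : 0 ≤ ybar := hc₀.trans hyc
  -- the tracial variance is `≤ (ȳ / 2)²`
  have hTle : T ≤ (1 + ε) * m * ybar ^ 2 := by
    refine le_of_mul_le_mul_right ?_ hmpos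
    calc T * m ≤ (1 + ε) * (m * ybar) ^ 2 := hmom
      _ = (1 + ε) * m * ybar ^ 2 * m := by ring
  have h1 : ε * m * ybar ^ 2 ≤ ε * D * ybar ^ 2 :=
    mul_le_mul_of_nonneg_right (mul_le_mul_of_nonneg_left hdeg hε) (sq_nonneg _)
  have h2 : ε * D * ybar ^ 2 ≤ 1 / 4 * ybar ^ 2 := mul_le_mul_of_nonneg_right hεD (sq_nonneg _)
  have hvar : T - m * ybar ^ 2 ≤ (ybar / 2) ^ 2 := by nlinarith [hTle, h1, h2]
  have hsqrt : Real.sqrt (T - m * ybar ^ 2) ≤ ybar / 2 :=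
    (Real.sqrt_le_sqrt hvar).trans_eq (Real.sqrt_sq (by linarith))
  linarith

end Moments

/-! ### The Hubbard side: one coupling, one side; then the closer -/

section Hubbard

/-- **Three trace clauses at one side ⇒ every ground state carries half the average.** Fix a
coupling `U`, a side `L`, a doping parameter `δ`, `c ≥ 0`, `ε ≥ 0` and `D` with `ε D ≤ 1/4`. If
the projection `P` onto the sector ground eigenspace `E₀ = szSector N_L 0 ⊓ ker (H - e₀)` of
`H = hubbardTorus 2 L 1 U` (`N_L = 2⌊(1-δ)L²/2⌋`) and `O = Δ_d† Δ_d` satisfy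
`c L⁴ · re tr P ≤ re tr (P O)`, `re tr (P O P O) · re tr P ≤ (1 + ε) (re tr (P O))²` and
`re tr P ≤ D`, then EVERY normalised ground state `ψ` of that sector has
`(c/2) L⁴ ≤ re ⟨ψ, O ψ⟩` (the tracial variance of the compression is `≤ ȳ²/4`; compression
variance head-count). The side-wise primitive of the RESHAPE line (`RESHAPE-ideator1.md`, item
`BirEveryOfMoments`); no representation theory and no genericity. Bhatia §I.2; Tasaki (2020)
App. A.2. [folklore] -/
theorem forall_groundState_bound_of_moments (U δ c ε D : ℝ) (hc : 0 ≤ c) (hε : 0 ≤ ε)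
    (hεD : ε * D ≤ 1 / 4) (L : ℕ) [NeZero L]
    (h : let N : ℕ := 2 * ⌊(1 - δ) * (L : ℝ) ^ 2 / 2⌋₊
      let H := hubbardTorus 2 L 1 U
      let S := szSector (Λ := FermionTorus 2 L) N 0
      let E₀ := S ⊓ Module.End.eigenspace (Matrix.toLin' H) ((H.minEnergyOn S : ℝ) : ℂ)
      let P := projMatrix (E₀.map (Fock.toEuclidean (ι := Orb (FermionTorus 2 L)) :
        Fock (Orb (FermionTorus 2 L)) →ₗ[ℂ] EuclideanSpace ℂ (Finset (Orb (FermionTorus 2 L)))))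
      let O := (pairField dWaveFormFactor L)ᴴ * pairField dWaveFormFactor L
      c * (L : ℝ) ^ 4 * P.trace.re ≤ (P * O).trace.re ∧
        (P * O * P * O).trace.re * P.trace.re ≤ (1 + ε) * (P * O).trace.re ^ 2 ∧
        P.trace.re ≤ D)
    (ψ : Fock (Orb (FermionTorus 2 L)))
    (hgs : IsGroundStateInSector (hubbardTorus 2 L 1 U) (2 * ⌊(1 - δ) * (L : ℝ) ^ 2 / 2⌋₊) 0 ψ)
    (hunit : star ψ ⬝ᵥ ψ = 1) :
    c / 2 * (L : ℝ) ^ 4 ≤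
      (star ψ ⬝ᵥ ((pairField dWaveFormFactor L)ᴴ * pairField dWaveFormFactor L) *ᵥ ψ).re := by
  obtain ⟨havg, hmom, hdeg⟩ := h
  -- name the objects of side `L`
  set A : Matrix (Finset (Orb (FermionTorus 2 L))) (Finset (Orb (FermionTorus 2 L))) ℂ :=
    (pairField dWaveFormFactor L)ᴴ * pairField dWaveFormFactor L with hA
  set H := hubbardTorus 2 L 1 U with hH
  set S := szSector (Λ := FermionTorus 2 L) (2 * ⌊(1 - δ) * (L : ℝ) ^ 2 / 2⌋₊) 0 with hS
  set E₀ := S ⊓ Module.End.eigenspace (Matrix.toLin' H) ((H.minEnergyOn S : ℝ) : ℂ) with hE₀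
  -- the Euclidean transport of the route statements IS `(WithLp.linearEquiv 2 ℂ _).symm`
  have hmap : E₀.map (Fock.toEuclidean (ι := Orb (FermionTorus 2 L)) :
      Fock (Orb (FermionTorus 2 L)) →ₗ[ℂ] EuclideanSpace ℂ (Finset (Orb (FermionTorus 2 L)))) =
      E₀.map ((WithLp.linearEquiv 2 ℂ (Finset (Orb (FermionTorus 2 L)) → ℂ)).symm :
        (Finset (Orb (FermionTorus 2 L)) → ℂ) →ₗ[ℂ]
          EuclideanSpace ℂ (Finset (Orb (FermionTorus 2 L)))) := rfl
  rw [hmap] at havg hmom hdeg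
  have hAH : A.IsHermitian := Matrix.isHermitian_conjTranspose_mul_self _
  have hψE : ψ ∈ E₀ := by
    refine Submodule.mem_inf.mpr ⟨hgs.1, ?_⟩
    rw [Module.End.mem_eigenspace_iff, Matrix.toLin'_apply]
    exact hgs.2.2
  have hne : E₀ ≠ ⊥ := by
    refine (Submodule.ne_bot_iff _).mpr ⟨ψ, hψE, ?_⟩
    rintro rfl
    simp at hunit
  have hc0 : 0 ≤ c * (L : ℝ) ^ 4 := by positivity
  have key := forall_unit_le_re_of_moments_free A hAH E₀ hne hc0 hε hεD havg hmom hdeg ψ hψE hunit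
  linarith [key]

/-- **CLOSER ⇐ a moment upgrade of the window average** (Theses-free form of
`birEveryGroundState_of_moments`, the RESHAPE line). Suppose that for all data `(δ, U₁, U₂, c)`
the window-average hypothesis of the crux yields ONE coupling `U` of the window, `c' > 0`,
`ε ≥ 0`, `D` with `ε D ≤ 1/4` and a threshold beyond which, at even sides, the sector ground
projection `P` and `O = Δ_d† Δ_d` obey the average clause `c' L⁴ re tr P ≤ re tr (P O)`, the
second-moment clause `re tr (P O P O) · re tr P ≤ (1 + ε) (re tr (P O))²` and the
bounded-degeneracy clause `re tr P ≤ D` (the MOMENT-TRANSFER residual; NOT proved — it is the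
engine-side upgrade the RESHAPE asks of the target). Then the body of
`Theses.BalabanIR.BirEveryGroundState` holds: `forall_groundState_bound_of_moments` gives every
normalised sector ground state `(c'/2) L⁴ ≤ re ⟨ψ, O ψ⟩` eventually, and the socket
`birEveryGroundState_structural_of_transfer` concludes. [folklore] -/
theorem birEveryGroundState_structural_of_moments
    (h : ∀ (δ U₁ U₂ c : ℝ), δ ∈ Set.Ioo (0:ℝ) (1/2) → 0 < U₁ → U₁ < U₂ → 0 < c →
      (∀ U ∈ Set.Ioo U₁ U₂, ∃ L₀ : ℕ, ∀ (L : ℕ) [NeZero L], L₀ ≤ L → Even L →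
        let N : ℕ := 2 * ⌊(1 - δ) * (L : ℝ) ^ 2 / 2⌋₊
        let H := hubbardTorus 2 L 1 U
        let S := szSector (Λ := FermionTorus 2 L) N 0
        let E₀ := S ⊓ Module.End.eigenspace (Matrix.toLin' H) ((H.minEnergyOn S : ℝ) : ℂ)
        let P := projMatrix (E₀.map (Fock.toEuclidean (ι := Orb (FermionTorus 2 L)) :
          Fock (Orb (FermionTorus 2 L)) →ₗ[ℂ] EuclideanSpace ℂ (Finset (Orb (FermionTorus 2 L)))))
        c * (L : ℝ) ^ 4 * P.trace.re ≤
          (P * ((pairField dWaveFormFactor L)ᴴ * pairField dWaveFormFactor L)).trace.re) →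
      ∃ U ∈ Set.Ioo U₁ U₂, ∃ c' ε D : ℝ, 0 < c' ∧ 0 ≤ ε ∧ ε * D ≤ 1 / 4 ∧
        ∃ L₀ : ℕ, ∀ (L : ℕ) [NeZero L], L₀ ≤ L → Even L →
        let N : ℕ := 2 * ⌊(1 - δ) * (L : ℝ) ^ 2 / 2⌋₊
        let H := hubbardTorus 2 L 1 U
        let S := szSector (Λ := FermionTorus 2 L) N 0
        let E₀ := S ⊓ Module.End.eigenspace (Matrix.toLin' H) ((H.minEnergyOn S : ℝ) : ℂ)
        let P := projMatrix (E₀.map (Fock.toEuclidean (ι := Orb (FermionTorus 2 L)) :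
          Fock (Orb (FermionTorus 2 L)) →ₗ[ℂ] EuclideanSpace ℂ (Finset (Orb (FermionTorus 2 L)))))
        let O := (pairField dWaveFormFactor L)ᴴ * pairField dWaveFormFactor L
        c' * (L : ℝ) ^ 4 * P.trace.re ≤ (P * O).trace.re ∧
          (P * O * P * O).trace.re * P.trace.re ≤ (1 + ε) * (P * O).trace.re ^ 2 ∧
          P.trace.re ≤ D) :
    ∀ (δ U₁ U₂ c : ℝ), δ ∈ Set.Ioo (0:ℝ) (1/2) → 0 < U₁ → U₁ < U₂ → 0 < c → (∀ U ∈ Set.Ioo U₁ U₂, ∃ L₀ : ℕ, ∀ (L : ℕ) [NeZero L], L₀ ≤ L → Even L → let N : ℕ := 2 * ⌊(1 - δ) * (L : ℝ) ^ 2 / 2⌋₊; let H := Literature.MathematicalPhysics.QuantumLattice.hubbardTorus 2 L 1 U; let S := Literature.MathematicalPhysics.QuantumLattice.szSector (Λ := Literature.MathematicalPhysics.QuantumLattice.FermionTorus 2 L) N 0; let E₀ := S ⊓ Module.End.eigenspace (Matrix.toLin' H) ((H.minEnergyOn S : ℝ) : ℂ); let P := Literature.MathematicalPhysics.QuantumLattice.projMatrix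 (E₀.map (Literature.MathematicalPhysics.QuantumLattice.Fock.toEuclidean (ι := Literature.MathematicalPhysics.QuantumLattice.Orb (Literature.MathematicalPhysics.QuantumLattice.FermionTorus 2 L)) : Literature.MathematicalPhysics.QuantumLattice.Fock (Literature.MathematicalPhysics.QuantumLattice.Orb (Literature.MathematicalPhysics.QuantumLattice.FermionTorus 2 L)) →ₗ[ℂ] EuclideanSpace ℂ (Finset (Literature.MathematicalPhysics.QuantumLattice.Orb (Literature.MathematicalPhysics.QuantumLattice.FermionTorus 2 L))))); c * (L : ℝ) ^ 4 * P.trace.re ≤ (P * (Matrix.conjTranspose (Literature.MathematicalPhysics.QuantumLattice.pairField Literature.MathematicalPhysics.QuantumLattice.dWaveFormFactor L) * Literature.MathematicalPhysics.QuantumLattice.pairField Literature.MathematicalPhysics.QuantumLattice.dWaveFormFactor L)).trace.re) → ∃ U ∈ Set.Ioo U₁ U₂, ∀ (N : ℕ → ℕ) (ψ : ∀ L, Literature.MathematicalPhysics.QuantumLattice.Fock (Literature.MathematicalPhysics.QuantumLattice.Orb (Literature.MathematicalPhysics.QuantumLattice.FermionTorus 2 L))), (∀ L, Even L → N L = 2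 * ⌊(1 - δ) * (L : ℝ) ^ 2 / 2⌋₊ ∧ star (ψ L) ⬝ᵥ ψ L = 1 ∧ Literature.MathematicalPhysics.QuantumLattice.IsGroundStateInSector (Literature.MathematicalPhysics.QuantumLattice.hubbardTorus 2 L 1 U) (N L) 0 (ψ L)) → Literature.Probability.LatticeModels.HasLongRangeOrder (fun k => Literature.Probability.LatticeModels.halfOpenBox 2 (2 * k)) (fun k => Literature.MathematicalPhysics.QuantumLattice.torusPullback (Literature.MathematicalPhysics.QuantumLattice.pairFieldCorr Literature.MathematicalPhysics.QuantumLattice.dWaveFormFactor ψ) (2 * k)) := by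
  refine birEveryGroundState_structural_of_transfer fun δ U₁ U₂ c hδ hU₁ hU₁₂ hc hyp => ?_
  obtain ⟨U, hU, c', ε, D, hc', hε, hεD, L₀, hL₀⟩ := h δ U₁ U₂ c hδ hU₁ hU₁₂ hc hyp
  exact ⟨U, hU, c' / 2, half_pos hc', L₀, fun L _ hL hLe ψ hgs hunit =>
    forall_groundState_bound_of_moments U δ c' ε D hc'.le hε hεD L (hL₀ L hL hLe) ψ hgs hunit⟩

end Hubbard

end Summit.HubbardSuperconductivity.HubbardSuperconductivity.Theorems
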